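import Summits.Ventures.QEC.Thresholds.CSSFamilyPhenomenologicalDepolarizing
import Literature.InformationTheory.QuantumCodes.PlanarSurfaceCodeAnisotropic
import Literature.InformationTheory.QuantumCodes.PlanarSurfaceCodeRadius
import HarnessLib

/-!
# The PLANAR surface codes under PHENOMENOLOGICAL DEPOLARIZING noise (three rates `p`, `q_X`, `q_Z`), sector-wise minimum-weight
# space-time decoding: `p ≤ .0151`, `q_X, q_Z ≤ .0101` ⇒ `P_fail → 0` — UNCONDITIONAL, kernel

Venture QEC, `Summits/Ventures/QEC/Thresholds/` (LADDER-QEC rung Q5 «toric/surface», PARTITION row 09 "depolarising;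
phenomenological"; qec-type-09 gen 5, item 09.PHDEPOL, companion of `CSSFamilyPhenomenologicalDepolarizing.lean`). The planar
surface code family `PlanarCode.code k` (qec-type-08's packaging of qec-lit-2's `planarHX k` / `planarHZ k` = `HGP(H, Hᵀ)` for the
`(k+1) × (k+2)` repetition matrix; one logical qubit, distance `k + 2`) under the three-rate law of `CSSPhenomenologicalDepolarizing.lean`:
qubits depolarized at rate `p` per round, `X`-check record wrong at `q_X`, `Z`-check record at `q_Z`, poly-bounded schedule `T`,
sector-wise space-time decoding by ANY pair of minimum-weight space-time decoders. The two sector two-rate theorems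
`planar_phenomThreshold_aniso` / `planar_phenomThreshold_aniso'` (qec-type-09 gen 4, Dumer–Kovalev–Pryadko constant `w + 2 = 6`:
`0 ≤ p', q ≤ ρ ≤ 1/2`, `100ρ(1-ρ) < 1`) and the sandwich `max(P^Z, P^X) ≤ P_fail ≤ P^Z + P^X` give:

| theorem | statement |
|---|---|
| `planar_depolPhenom_belowThreshold_of_rate` | `2p/3, q_X, q_Z ≤ ρ ≤ 1/2`, `100ρ(1-ρ) < 1` ⇒ `P_fail → 0` |
| `planar_depolPhenom_belowThreshold_0151_0101` | decimals: **`p ≤ .0151`, `q_X, q_Z ≤ .0101`** ⇒ `P_fail → 0` |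

All UNCONDITIONAL, tier CERTIFIED (kernel), axioms standard, 0 named facts; certified LOWER bound on the threshold region for
sector-wise (correlation-blind) minimum-weight space-time decoding; the constants are the cluster-expansion ones (`p₀(5) ≈ .0101`),
not the self-avoiding-walk ones (the planar SAW route is not in the tree). Theorem-only file.

## References

* [DumerKovalevPryadko2015] I. Dumer, A. A. Kovalev, L. P. Pryadko, PRL 115 (2015) 050502, Thm 3 with p. 5 (w → w + 2), eq.
  (succesful-decoding-depolarizing).
* [AliferisGottesmanPreskill2006] P. Aliferis, D. Gottesman, J. Preskill, arXiv:quant-ph/0504218, §8.2 (chunk p0026 L11: depolarizing).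
* [TillichZemor2014] J.-P. Tillich, G. Zémor, IEEE Trans. IT 60 (2014) 1193, §3 (the planar code as a hypergraph product).
-/

noncomputable section

namespace Summit.Ventures.QEC.Thresholds

open Filter Topology Finset Matrix
open Literature.InformationTheory.QuantumCodes

/-- **Planar surface codes, phenomenological depolarizing noise, sector-wise minimum-weight space-time decoding**: for every
poly-bounded schedule `T`, every pair of minimum-weight space-time decoders (`DZ` on the `X`-check record `planarHX`, `DX` on
the `Z`-check record `planarHZ`) and all rates with `2p/3, q_X, q_Z ≤ ρ ≤ 1/2`, `100ρ(1-ρ) < 1`: `P_fail → 0`. UNCONDITIONAL.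
[cite: DumerKovalevPryadko2015, Thm 3 with p. 5 and eq. (succesful-decoding-depolarizing)] [cite: AliferisGottesmanPreskill2006, §8.2 (chunk p0026 L11)] -/
theorem planar_depolPhenom_belowThreshold_of_rate (T : ℕ → ℕ) (hT : ToricCode.IsPolyBounded T)
    (DZ : ∀ k, CSSPhenom.STDecoder (PlanarCheck k) (PlanarQubit k) (T k))
    (DX : ∀ k, CSSPhenom.STDecoder (PlanarZCheck k) (PlanarQubit k) (T k))
    (hDZ : ∀ k, (DZ k).IsMinWeight (CSSPhenom.stSyn (planarHX k) (T k))
      (CSSPhenom.stCycles (planarHX k) (T k)) hammingNorm)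
    (hDX : ∀ k, (DX k).IsMinWeight (CSSPhenom.stSyn (planarHZ k) (T k))
      (CSSPhenom.stCycles (planarHZ k) (T k)) hammingNorm)
    {p qX qZ ρ : ℝ} (hp0 : 0 ≤ p) (hpρ : 2 * p / 3 ≤ ρ) (hqX0 : 0 ≤ qX) (hqXρ : qX ≤ ρ) (hqZ0 : 0 ≤ qZ)
    (hqZρ : qZ ≤ ρ) (hρ : ρ ≤ 1 / 2) (h100 : 100 * (ρ * (1 - ρ)) < 1) :
    Tendsto (fun k => (PlanarCode.code k).depolPhenomFailureProb (T k) (DZ k) (DX k) p qX qZ) atTop (𝓝 0) := by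
  have hq0 : 0 ≤ 2 * p / 3 := by positivity
  have hZ := planar_phenomThreshold_aniso T hT DZ hDZ hq0 hqX0 hpρ hqXρ hρ h100
  have hX := planar_phenomThreshold_aniso' T hT DX hDX hq0 hqZ0 hpρ hqZρ hρ h100
  exact (CSSCode.depolPhenom_belowThreshold_iff (fun k => PlanarCode.code k) T DZ DX hp0 (by linarith) hqX0
    (by linarith) hqZ0 (by linarith)).2 ⟨hZ, hX⟩

/-- **Decimal form: `p ≤ .0151`, `q_X, q_Z ≤ .0101` ⇒ `P_fail → 0`** for the planar surface codes under phenomenological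
depolarizing noise (sector-wise minimum-weight space-time decoding, poly `T`) — UNCONDITIONAL, kernel.
[cite: DumerKovalevPryadko2015, Thm 3 with p. 5] [cite: AliferisGottesmanPreskill2006, §8.2 (chunk p0026 L11)] -/
theorem planar_depolPhenom_belowThreshold_0151_0101 (T : ℕ → ℕ) (hT : ToricCode.IsPolyBounded T)
    (DZ : ∀ k, CSSPhenom.STDecoder (PlanarCheck k) (PlanarQubit k) (T k))
    (DX : ∀ k, CSSPhenom.STDecoder (PlanarZCheck k) (PlanarQubit k) (T k))
    (hDZ : ∀ k, (DZ k).IsMinWeight (CSSPhenom.stSyn (planarHX k) (T k))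
      (CSSPhenom.stCycles (planarHX k) (T k)) hammingNorm)
    (hDX : ∀ k, (DX k).IsMinWeight (CSSPhenom.stSyn (planarHZ k) (T k))
      (CSSPhenom.stCycles (planarHZ k) (T k)) hammingNorm)
    {p qX qZ : ℝ} (hp0 : 0 ≤ p) (hp : p ≤ 0.0151) (hqX0 : 0 ≤ qX) (hqX : qX ≤ 0.0101) (hqZ0 : 0 ≤ qZ)
    (hqZ : qZ ≤ 0.0101) :
    Tendsto (fun k => (PlanarCode.code k).depolPhenomFailureProb (T k) (DZ k) (DX k) p qX qZ) atTop (𝓝 0) :=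
  planar_depolPhenom_belowThreshold_of_rate T hT DZ DX hDZ hDX (ρ := 0.0101) hp0 (by linarith) hqX0 hqX hqZ0 hqZ
    (by norm_num) (by norm_num)

end Summit.Ventures.QEC.Thresholds

end
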